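import Summits.BirchSwinnertonDyer.Rank1Residual.X11b.KummerLocalTorsionSaturation
import Summits.BirchSwinnertonDyer.Rank1Residual.GaloisImage.KolyvaginPrimeLocalShape
import HarnessLib

/-!
# Unramified classes versus the local Kummer image at a place `v ∤ p`:
# `H¹_ur(K_v, E[p]) ⊓ 𝓚_v = ⊥` when `E(K_v^nr)[p^∞]` is killed by `p`, and the ADDITIVE TAMAGAWA
# WITNESS `∃ u ∈ H¹_ur(K_v, E[p]), u ∉ 𝓚_v`
# (cell `b2b-bsdres`, team n1011, seat p06 GEN 4; OWNERS row T-E3g-ADD, FILE A)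

HONEST FRAMING (cell `b2b-bsdres`, run/shared/lean/b2b/bsd-rank1-residual/, verbatim in every
file): the goal of the cell is to DELETE the COMBINATION-SHAPED residual classes of the
Birch–Swinnerton-Dyer formula for ALL analytic-rank `≤ 1` elliptic curves over `ℚ` — "full BSD
formula for every rank `≤ 1` curve in class `C`" assembled STRICTLY from published theorems — so
that the rank-`≤ 1` remainder becomes exactly the CONSTRUCTION-SHAPED classes, which are TYPED
(missing-input `Prop`s), NOT attempted. This is not "finishing BSD". Team n1011 (N10/N11: X4 ∧
`p = 3`): research routes on CONSTRUCTION-SHAPED classes; census output = EVIDENCE / conjecture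
items, never a Literature fact; RESIDUAL-MAP marks UNCHANGED; nothing is booked by this file.
THEOREMS ONLY: no definition, no named fact, nothing asserted; local Galois cohomology tools.

## What and why (row T-E3g-ADD; consumer: p10's T-E3g-BUD0 FILE 4 "per-prime witness")

The level-`0` Route-G budget door (`Additive/BudgetFromRationalClasses.lean`,
`Additive/RationalClassesToLayerZero.lean`, `Additive/UnramifiedClassesLocal.lean`) counts the
`p`-Selmer group of `E[p]` for the Kummer structure RELAXED to "Kummer + unramified" at a finite set
`T` of places `v ∤ p`, and gains a factor `[H¹_ur(K_v, E[p]) ⊔ 𝓚_v : 𝓚_v]` at each `v ∈ T`; the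
per-prime input is a WITNESS `∃ u ∈ H¹_ur(K_v, E[p]), u ∉ 𝓚_v` (skel/T-E3g-BUD0 §2 FILE 4, §4).
At a split multiplicative `v` this is a Tate-curve computation (FILE 5 of that row); THIS FILE
gives the mechanism that serves the ADDITIVE Tamagawa places (`v ∤ p`, `p ∣ c_v`, forced
`p = 3`, Kodaira IV / IV*), in three steps, for an elliptic curve over ANY number field `K` and ANY
finite place `v ∤ p`:

* §1 (generic, any non-archimedean local field `F`, any injective intertwining map
  `i : A ↪ B` of discrete `Γ_F`-modules with `A` killed by `n` and `range i ⊇ B[n]`):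
  **if every `I_F`-fixed point of `B` is killed by `n`, then
  `H¹_ur(F, A) ⊓ ker (H¹(F, A) → H¹(F, B)) = ⊥`** — a class in the kernel is a connecting class
  `δ(b)` (`n • b ∈ B^{Γ_F}`, X11b `Levels.map_one_eq_zero_iff_exists`); if it is also unramified,
  `σ b − b = σ (i w) − i w` on `I_F` for some `w ∈ A` (X11b `LocBridge.mem_unramifiedSubgroup_one_iff_exists`),
  so `b − i w ∈ B^{I_F}` is killed by `n`, whence `n • b = 0` and `δ(b) = 0`
  (`Levels.connectingClass_eq_zero_iff`);
* §2 (generic): **`H¹_ur(F, A)` is the image of the injective inflation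
  `H¹(Γ_F/I_F, A^{I_F}) ↪ H¹(F, A)` for EVERY discrete module `A`** (no "unramified module"
  hypothesis), hence `#H¹_ur(F, A) = #A^{Γ_F}` for finite `A` (the tree's
  `GaloisImage.natCard_unramifiedSubgroup_eq_natCard_invariants` assumed `I_F` acts trivially on
  `A`; Milne *ADT* I Lemma 2.9 / Rubin PCMI Prop. 1.4.13 need not), and `H¹_ur(F, A) ≠ ⊥` as soon as
  `A^{Γ_F} ≠ 0`;
* §3 (elliptic curves, `v ∤ p`): with X11b `LevelKummer.kummerLocalConditionAt_eq_ker_map_primaryInclusion`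
  (`𝓚_v = ker (H¹(K_v, E[p^k]) → H¹(K_v, E[p^∞]))`, torsion saturation at `v ∤ p`):
  **`H¹_ur(K_v, E[p^k]) ⊓ 𝓚_v = ⊥` whenever `(E[p^∞])^{I_v} = E(K_v^nr)[p^∞]` is killed by `p^k`**
  (hypothesis `hI`, THEOREM-SHAPED: true at every additive `v ∤ p` for `p` odd — Kodaira–Néron over
  `K_v^nr`, `#E(K_v^nr)/E₀(K_v^nr) ≤ 4`, `E₀(K_v^nr)` without `p`-torsion — the sequel FILE B of
  this row; FALSE at good `v ∤ p`, where `I_v` acts trivially on `E[p^∞]`), the `k = 1` form in the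
  `(p : ℤ)` currency of `RationalClassesToLayerZero` / `UnramifiedClassesLocal`, the WITNESS
  `∃ u ∈ H¹_ur(K_v, E[p]), u ∉ 𝓚_v` from `hI` and ONE nonzero point of `E(K_v)[p]` (hypothesis
  `hne`, THEOREM-SHAPED: at an additive `v ∤ p`, `E(K_v)[p] ≠ 0 ⟸ p ∣ c_v` — FILE C), and the
  index form `#(H¹_ur ⊔ 𝓚_v) = #E(K_v)[p] · #𝓚_v`.

Greenberg's `p^∞`-shadow of the same computation: "at additive `v ∤ p`, `|ker r_v| = c_v^{(p)}`,
`E₀(F_v)` being pro-`l`" (LNM 1716 p. 74).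

References: J. S. Milne, *Arithmetic Duality Theorems* (2006) I §2 Lemma 2.9, I §3 Prop. 3.8
[MilneADT2006]; K. Rubin, *Euler systems and Kolyvagin systems* (PCMI 18) Prop. 1.4.13
[Rubin2011]; R. Greenberg, LNM 1716 (1999) §2, p. 74 [GreenbergLNM1716]; J.-P. Serre, *Galois
Cohomology* I §2.6 (inflation–restriction) [SerreGaloisCohomology1997]; J. H. Silverman, *AEC*
VII.6.1 / *ATAEC* IV.9 Table 4.1 (component groups at additive places) [SilvermanAEC2009].
-/

set_option autoImplicit false

noncomputable section

open scoped Classical ContRepresentation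

open CategoryTheory Field ValuativeRel NumberField IsDedekindDomain Function
open Literature.NumberTheory.EllipticCurves Literature.NumberTheory.GaloisRepresentations
  Literature.NumberTheory.GaloisRepresentations.IsNonarchimedeanLocalField
open Summit.BirchSwinnertonDyer.Rank1Residual.X11b

namespace Summit.BirchSwinnertonDyer.Rank1Residual.Additive

universe u

/-! ### §1 Generic: unramified connecting classes vanish when `B^{I_F}` is killed by `n` -/

section Generic

variable {F : Type u} [Field F] [ValuativeRel F] [TopologicalSpace F] [IsNonarchimedeanLocalField F]
  {A B : Type u} [AddCommGroup A] [TopologicalSpace A] [DiscreteTopology A]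
  [AddCommGroup B] [TopologicalSpace B] [DiscreteTopology B]
  {ρA : DiscreteGaloisModule F A} {ρB : DiscreteGaloisModule F B}

/-- **`H¹_ur(F, A) ⊓ ker (H¹(F, A) → H¹(F, B)) = ⊥` when `B^{I_F}` is killed by `n`.** For an
injective intertwining map `i : A ↪ B` of discrete `Γ_F`-modules over a non-archimedean local field
`F`, with `A` killed by `n` and `range i ⊇ B[n]` (the Kummer-type sequence
`0 → A → B —n→ B`): if every point of `B` fixed by the inertia group `I_F` is killed by `n`, then an
UNRAMIFIED class of `H¹(F, A)` dying in `H¹(F, B)` is zero. (It is `δ(b)` with `n • b ∈ B^{Γ_F}`;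
unramified means `σ b − b = σ(i w) − i w` on `I_F`, so `b − i w ∈ B^{I_F}`, `n • b = n • (b − i w) = 0`,
and `δ(b) = 0`.) [cite: MilneADT2006, Ch. I §2 (unramified cohomology) and §3 Prop. 3.8]
[cite: GreenbergLNM1716, §2, p. 74] -/
theorem unramifiedSubgroup_inf_ker_map_eq_bot_of_inertia_torsion
    {i : ρA.toContRepresentation →ⁱL ρB.toContRepresentation} {n : ℕ}
    (hrange : ∀ b : B, n • b = 0 → ∃ a : A, i a = b) (hinj : Function.Injective i)
    (hA : ∀ a : A, n • a = 0)
    (hI : ∀ b : B, (∀ τ ∈ absInertia F, ρB τ b = b) → n • b = 0) :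
    DiscreteGaloisModule.unramifiedSubgroup ρA 1 ⊓ (galoisCohomology.map i 1).ker = ⊥ := by
  rw [eq_bot_iff]
  rintro c ⟨hur, hker⟩
  rw [AddSubgroup.mem_bot]
  obtain ⟨b, hb, rfl⟩ :=
    (Levels.map_one_eq_zero_iff_exists (hrange := hrange) hinj hA c).mp hker
  -- the connecting class is the class of the lifted coboundary of `b`; read "unramified" on it
  obtain ⟨w, hw⟩ := (LocBridge.mem_unramifiedSubgroup_one_iff_exists ρA
    (Levels.liftCocycle i n hrange hinj (Levels.cobCocycle ρB b)
      (Levels.nsmul_cobCocycle_apply_eq_zero n hb))).mp hur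
  -- `b - i w` is fixed by the inertia group
  have hfix : ∀ τ ∈ absInertia F, ρB τ (b - i w) = b - i w := fun τ hτ ↦ by
    have h := congrArg i (hw τ hτ)
    rw [Levels.apply_liftCocycle, Levels.cobCocycle_apply, map_sub] at h
    have h' : i (ρA τ w) = ρB τ (i w) := i.isIntertwining τ w
    rw [h'] at h
    rw [map_sub]
    calc ρB τ b - ρB τ (i w) = (ρB τ b - b) - (ρB τ (i w) - i w) + (b - i w) := by abel
      _ = b - i w := by rw [h, sub_self, zero_add]
  -- hence `n • b = 0`
  have hnb : n • b = 0 := by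
    have h0 := hI _ hfix
    rwa [smul_sub, ← map_nsmul, hA, map_zero, sub_zero] at h0
  rw [Levels.connectingClass_eq_zero_iff hinj hA]
  exact ⟨0, fun σ ↦ map_zero _, by rw [smul_zero, hnb]⟩

/-- Disjointness form of `unramifiedSubgroup_inf_ker_map_eq_bot_of_inertia_torsion`.
[cite: MilneADT2006, Ch. I §2 and §3 Prop. 3.8] -/
theorem disjoint_unramifiedSubgroup_ker_map_of_inertia_torsion
    {i : ρA.toContRepresentation →ⁱL ρB.toContRepresentation} {n : ℕ}
    (hrange : ∀ b : B, n • b = 0 → ∃ a : A, i a = b) (hinj : Function.Injective i)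
    (hA : ∀ a : A, n • a = 0)
    (hI : ∀ b : B, (∀ τ ∈ absInertia F, ρB τ b = b) → n • b = 0) :
    Disjoint (DiscreteGaloisModule.unramifiedSubgroup ρA 1) (galoisCohomology.map i 1).ker := by
  rw [disjoint_iff]
  exact unramifiedSubgroup_inf_ker_map_eq_bot_of_inertia_torsion hrange hinj hA hI

end Generic

/-! ### §2 Generic: `H¹_ur(F, A)` is the image of inflation from `Γ_F/I_F`, for EVERY `A` -/

section Inflation

variable {F : Type u} [Field F] [ValuativeRel F] [TopologicalSpace F] [IsNonarchimedeanLocalField F]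
  {A : Type u} [AddCommGroup A] [TopologicalSpace A] [DiscreteTopology A]
  (ρ : DiscreteGaloisModule F A)

/-- **`H¹_ur(F, A) = inf (H¹(Γ_F/I_F, A^{I_F}))` for every discrete module `A`** (no assumption
on the inertia action): a class is unramified iff it is principal on `I_F = Gal(F̄/F^{nr})`
(X11b `LocBridge.mem_unramifiedSubgroup_one_iff_exists`) iff its restriction to `I_F` vanishes iff
it is inflated (inflation–restriction, `infOne_exact_resSubgroup`). Milne *ADT* I §2
(`H¹_ur = H¹(G/I, M^I) = ker (H¹(G, M) → H¹(I, M))`).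
[cite: MilneADT2006, Ch. I §2 (unramified cohomology)] [cite: SerreGaloisCohomology1997, I §2.6 (b)] -/
theorem mem_unramifiedSubgroup_one_iff_mem_range_infOne (c : galoisCohomology ρ 1) :
    c ∈ DiscreteGaloisModule.unramifiedSubgroup ρ 1 ↔ c ∈ Set.range (infOne (galUnr F) ρ) := by
  obtain ⟨φ, rfl⟩ := oneCocycleClass_surjective ρ.toTopRep c
  refine (LocBridge.mem_unramifiedSubgroup_one_iff_exists ρ φ).trans
    (Iff.trans ?_ (infOne_exact_resSubgroup (galUnr F) ρ _))
  rw [resSubgroup_oneCocycleClass, oneCocycleClass_eq_zero_iff]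
  constructor
  · rintro ⟨w, hw⟩
    refine ⟨w, fun τ ↦ ?_⟩
    rw [contOneCocycles.pullback_apply]
    exact hw τ (by rw [← galUnr_eq_absInertia F]; exact τ.2)
  · rintro ⟨w, hw⟩
    refine ⟨w, fun τ hτ ↦ ?_⟩
    have hτ' : τ ∈ galUnr F := by rw [galUnr_eq_absInertia F]; exact hτ
    have h := hw ⟨τ, hτ'⟩
    rw [contOneCocycles.pullback_apply] at h
    exact h

/-- **`#H¹_ur(F, A) = #A^{Γ_F}` for every FINITE discrete module `A`** (Milne *ADT* I Lemma 2.9;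
Rubin PCMI Prop. 1.4.13 (1) as a count): `H¹_ur` is the image of the injective inflation from
`Γ_F/I_F` and `h¹ = h⁰` for finite modules over `Γ_F/I_F ≅ Ẑ`
(`natCard_continuousCohomology_one_quotient_galUnr`). The tree's
`GaloisImage.natCard_unramifiedSubgroup_eq_natCard_invariants` is the case of trivial inertia
action; this is the general case. [cite: MilneADT2006, Ch. I, Lemma 2.9]
[cite: Rubin2011, Prop. 1.4.13 (1) (p. 9)] -/
theorem natCard_unramifiedSubgroup_eq_natCard_invariants_general [Finite A] :
    Nat.card (DiscreteGaloisModule.unramifiedSubgroup ρ 1) = Nat.card ρ.toTopRep.ρ.invariants := by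
  haveI := absoluteGaloisGroup_compactSpace F
  set N : Subgroup (absoluteGaloisGroup F) := galUnr F
  have e : continuousCohomology 1 (ρ.quotientInvariants N).toTopRep ≃
      DiscreteGaloisModule.unramifiedSubgroup ρ 1 :=
    Equiv.ofBijective
      (fun x ↦ ⟨infOne N ρ x, (mem_unramifiedSubgroup_one_iff_mem_range_infOne ρ _).mpr ⟨x, rfl⟩⟩)
      ⟨fun x y hxy ↦ infOne_injective N ρ (congrArg Subtype.val hxy),
        fun c ↦ by
          obtain ⟨x, hx⟩ := (mem_unramifiedSubgroup_one_iff_mem_range_infOne ρ c.1).mp c.2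
          exact ⟨x, Subtype.ext hx⟩⟩
  rw [← Nat.card_congr e, natCard_continuousCohomology_one_quotient_galUnr F _ (ρ.quotientInvariants N)]
  exact Nat.card_congr (invariantsQuotientInvariantsEquiv N ρ)

/-- **A nonzero `Γ_F`-fixed point gives a nonzero unramified class** (finite `A`): if `a ≠ 0` is
fixed by `Γ_F` then `#H¹_ur(F, A) = #A^{Γ_F} ≥ 2`. [cite: MilneADT2006, Ch. I, Lemma 2.9] -/
theorem exists_mem_unramifiedSubgroup_ne_zero [Finite A] {a : A} (ha : a ≠ 0)
    (hfix : ∀ σ : absoluteGaloisGroup F, ρ σ a = a) :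
    ∃ c ∈ DiscreteGaloisModule.unramifiedSubgroup ρ 1, c ≠ 0 := by
  have hmem : a ∈ ρ.toTopRep.ρ.invariants := (Representation.mem_invariants _ a).mpr hfix
  haveI : Finite ρ.toTopRep.ρ.invariants := Subtype.finite
  have h2 : 1 < Nat.card (DiscreteGaloisModule.unramifiedSubgroup ρ 1) := by
    rw [natCard_unramifiedSubgroup_eq_natCard_invariants_general ρ, Finite.one_lt_card_iff_nontrivial]
    exact ⟨⟨⟨a, hmem⟩, ⟨0, zero_mem _⟩, fun h ↦ ha (congrArg Subtype.val h)⟩⟩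
  haveI : Finite (DiscreteGaloisModule.unramifiedSubgroup ρ 1) :=
    Nat.finite_of_card_ne_zero (by omega)
  haveI : Nontrivial (DiscreteGaloisModule.unramifiedSubgroup ρ 1) :=
    Finite.one_lt_card_iff_nontrivial.mp h2
  obtain ⟨c, hc⟩ := exists_ne (0 : DiscreteGaloisModule.unramifiedSubgroup ρ 1)
  exact ⟨c, c.2, fun h ↦ hc (Subtype.ext h)⟩

end Inflation

/-! ### §3 Elliptic curves at `v ∤ p`: `H¹_ur(K_v, E[p^k]) ⊓ 𝓚_v = ⊥` and the witness -/

section Curve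

variable {K : Type u} [Field K] [NumberField K] (W : WeierstrassCurve K) [W.IsElliptic] (p : ℕ)
  [hp : Fact p.Prime] (v : HeightOneSpectrum (𝓞 K))

/-- **`H¹_ur(K_v, E[p^k]) ⊓ 𝓚_v = ⊥` at `v ∤ p` when `E(K_v^nr)[p^∞]` is killed by `p^k`.** For an
elliptic curve `E` over a number field `K`, a prime `p`, a finite place `v ∤ p` and `k`: if every
point of `E[p^∞](K̄)` fixed by the inertia group `I_v = absInertia K_v` (i.e. every point of
`E(K_v^nr)[p^∞]`) is killed by `p^k`, then no nonzero class of `H¹(K_v, E[p^k])` is both unramified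
and in the local Kummer condition `𝓚_v = im (E(K_v)/p^k ↪ H¹(K_v, E[p^k]))`. (§1 applied to
`E[p^k] ↪ E[p^∞]`, the Kummer condition being `ker (H¹(K_v, E[p^k]) → H¹(K_v, E[p^∞]))` at `v ∤ p`:
X11b `LevelKummer.kummerLocalConditionAt_eq_ker_map_primaryInclusion`.) The hypothesis holds at
every ADDITIVE `v ∤ p` for odd `p` (Kodaira–Néron: `E(K_v^nr)[p^∞] ↪ E(K_v^nr)/E₀(K_v^nr)`, of
order `≤ 4`) and fails at good `v ∤ p`. [cite: GreenbergLNM1716, §2, p. 74]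
[cite: MilneADT2006, Ch. I §3 Prop. 3.8] -/
theorem unramifiedSubgroup_inf_kummerLocalConditionAt_pow_eq_bot_of_inertia_torsion
    (hpv : ((p : ℕ) : 𝓞 K) ∉ v.asIdeal) (k : ℕ)
    (hI : ∀ Q : W.geomPrimaryTorsion p,
      (∀ τ ∈ absInertia (v.adicCompletion K),
        GaloisRep.restrictField (v.adicCompletion K) (LocBridge.primaryGaloisModule W p) τ Q = Q) →
      p ^ k • Q = 0) :
    DiscreteGaloisModule.unramifiedSubgroup
        (GaloisRep.restrictField (v.adicCompletion K) (W.torsionGaloisModule ((p ^ k : ℕ) : ℤ))) 1 ⊓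
      W.kummerLocalConditionAt ((p ^ k : ℕ) : ℤ) (v.adicCompletion K) = ⊥ := by
  have hn : ((p ^ k : ℕ) : ℤ) ≠ 0 := by exact_mod_cast pow_ne_zero k hp.out.ne_zero
  rw [LevelKummer.kummerLocalConditionAt_eq_ker_map_primaryInclusion W p k v hpv hn]
  exact unramifiedSubgroup_inf_ker_map_eq_bot_of_inertia_torsion
    (Levels.exists_primaryInclusion_restrictField_eq_of_nsmul_eq_zero W p k (v.adicCompletion K))
    (Levels.primaryInclusion_restrictField_injective W p k (v.adicCompletion K))
    (Levels.pow_nsmul_geomTorsion_eq_zero W p k) hI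

/-- **`H¹_ur(K_v, E[p]) ⊓ 𝓚_v = ⊥` at `v ∤ p` when `E(K_v^nr)[p^∞]` is killed by `p`** — the
`k = 1` case in the `(p : ℤ)` currency of `RationalClassesToLayerZero` / `UnramifiedClassesLocal`.
[cite: GreenbergLNM1716, §2, p. 74] [cite: MilneADT2006, Ch. I §3 Prop. 3.8] -/
theorem unramifiedSubgroup_inf_kummerLocalConditionAt_eq_bot_of_inertia_torsion
    (hpv : ((p : ℕ) : 𝓞 K) ∉ v.asIdeal)
    (hI : ∀ Q : W.geomPrimaryTorsion p,
      (∀ τ ∈ absInertia (v.adicCompletion K),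
        GaloisRep.restrictField (v.adicCompletion K) (LocBridge.primaryGaloisModule W p) τ Q = Q) →
      p • Q = 0) :
    DiscreteGaloisModule.unramifiedSubgroup
        (GaloisRep.restrictField (v.adicCompletion K) (W.torsionGaloisModule (p : ℤ))) 1 ⊓
      W.kummerLocalConditionAt (p : ℤ) (v.adicCompletion K) = ⊥ := by
  have h := unramifiedSubgroup_inf_kummerLocalConditionAt_pow_eq_bot_of_inertia_torsion W p v hpv 1
    (fun Q hQ ↦ by rw [pow_one]; exact hI Q hQ)
  rw [pow_one] at h
  exact h

/-- Disjointness form. [cite: GreenbergLNM1716, §2, p. 74] -/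
theorem disjoint_unramifiedSubgroup_kummerLocalConditionAt_of_inertia_torsion
    (hpv : ((p : ℕ) : 𝓞 K) ∉ v.asIdeal)
    (hI : ∀ Q : W.geomPrimaryTorsion p,
      (∀ τ ∈ absInertia (v.adicCompletion K),
        GaloisRep.restrictField (v.adicCompletion K) (LocBridge.primaryGaloisModule W p) τ Q = Q) →
      p • Q = 0) :
    Disjoint
      (DiscreteGaloisModule.unramifiedSubgroup
        (GaloisRep.restrictField (v.adicCompletion K) (W.torsionGaloisModule (p : ℤ))) 1)
      (W.kummerLocalConditionAt (p : ℤ) (v.adicCompletion K)) := by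
  rw [disjoint_iff]
  exact unramifiedSubgroup_inf_kummerLocalConditionAt_eq_bot_of_inertia_torsion W p v hpv hI

/-- **THE WITNESS: `∃ u ∈ H¹_ur(K_v, E[p]), u ∉ 𝓚_v`** at a finite `v ∤ p` where `E(K_v^nr)[p^∞]`
is killed by `p` (`hI`) and `E[p]` has a nonzero `Γ_{K_v}`-fixed point (`hne`: a nonzero point of
`E(K_v)[p]`) — the per-prime input of the relaxed-Kummer count of T-E3g-BUD0 FILE 4. At an
ADDITIVE Tamagawa place (`v ∤ p`, `p` odd, `p ∣ c_v`: Kodaira IV / IV*, `p = 3 = c_v`) both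
hypotheses hold (sequel files of this row). [cite: GreenbergLNM1716, §2, p. 74]
[cite: MilneADT2006, Ch. I, Lemma 2.9 and §3 Prop. 3.8] -/
theorem exists_mem_unramifiedSubgroup_not_mem_kummerLocalConditionAt_of_inertia_torsion
    (hpv : ((p : ℕ) : 𝓞 K) ∉ v.asIdeal)
    (hI : ∀ Q : W.geomPrimaryTorsion p,
      (∀ τ ∈ absInertia (v.adicCompletion K),
        GaloisRep.restrictField (v.adicCompletion K) (LocBridge.primaryGaloisModule W p) τ Q = Q) →
      p • Q = 0)
    {P : W.geomTorsion (p : ℤ)} (hP : P ≠ 0)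
    (hPfix : ∀ σ : absoluteGaloisGroup (v.adicCompletion K),
      GaloisRep.restrictField (v.adicCompletion K) (W.torsionGaloisModule (p : ℤ)) σ P = P) :
    ∃ u ∈ DiscreteGaloisModule.unramifiedSubgroup
        (GaloisRep.restrictField (v.adicCompletion K) (W.torsionGaloisModule (p : ℤ))) 1,
      u ∉ W.kummerLocalConditionAt (p : ℤ) (v.adicCompletion K) := by
  haveI : NeZero p := ⟨hp.out.ne_zero⟩
  haveI : Finite (W.geomTorsion (p : ℤ)) := finite_geomTorsion_of_neZero W p
  obtain ⟨c, hc, hc0⟩ := exists_mem_unramifiedSubgroup_ne_zero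
    (GaloisRep.restrictField (v.adicCompletion K) (W.torsionGaloisModule (p : ℤ))) hP hPfix
  refine ⟨c, hc, fun hK ↦ hc0 ?_⟩
  have h := unramifiedSubgroup_inf_kummerLocalConditionAt_eq_bot_of_inertia_torsion W p v hpv hI
  rw [eq_bot_iff] at h
  exact AddSubgroup.mem_bot.mp (h ⟨hc, hK⟩)

/-- **A nonzero `p`-torsion point of `E(L)` gives a nonzero `Γ_L`-fixed point of `E[p](K̄)|_{Γ_L}`**
for any `K`-field `L` (a completion `K_v`): transport along the tree's equivariant torsion
transfer `torsionTransferEquiv : E[n](K̄) ≃+ (W⁄L)[n](L̄)` (`torsionTransferEquiv_symm_smul`) of the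
`Γ_L`-fixed point `toGeomPoints (W⁄L) T`. [cite: SilvermanAEC2009, Cor. III.6.4(b) and VIII.§1] -/
theorem exists_geomTorsion_ne_zero_fixed_of_point (L : Type u) [Field L] [Algebra K L]
    {T : (W.baseChange L).toAffine.Point} (hT : T ≠ 0) (hpT : (p : ℤ) • T = 0) :
    ∃ P : W.geomTorsion (p : ℤ), P ≠ 0 ∧
      ∀ σ : absoluteGaloisGroup L, GaloisRep.restrictField L (W.torsionGaloisModule (p : ℤ)) σ P = P := by
  have hn : (p : ℤ) ≠ 0 := by exact_mod_cast hp.out.ne_zero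
  -- the point `T` inside `(W⁄L)[p](L̄)`, fixed by `Γ_L`
  let S : (W.baseChange L).geomTorsion (p : ℤ) :=
    ⟨WeierstrassCurve.toGeomPoints (W.baseChange L) T,
      ((W.baseChange L).mem_geomTorsion_iff (p : ℤ) _).mpr (by rw [← map_zsmul, hpT, map_zero])⟩
  have hS0 : S ≠ 0 := fun h ↦ hT (WeierstrassCurve.toGeomPoints_injective (W.baseChange L)
    (by rw [map_zero]; exact congrArg Subtype.val h))
  have hSfix : ∀ σ : absoluteGaloisGroup L, σ • S = S := fun σ ↦
    Subtype.ext (by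
      rw [AddSubgroup.torsionBy.coe_smul]
      exact WeierstrassCurve.smul_toGeomPoints (W.baseChange L) σ T)
  refine ⟨(W.torsionTransferEquiv (E := L) hn).symm S, fun h ↦ hS0 ?_, fun σ ↦ ?_⟩
  · rw [← (W.torsionTransferEquiv (E := L) hn).apply_symm_apply S, h, map_zero]
  · rw [GaloisRep.restrictField_apply, WeierstrassCurve.torsionGaloisModule_apply_apply,
      ← W.torsionTransferEquiv_symm_smul hn σ S, hSfix]

/-- **THE WITNESS, from a nonzero point of `E(K_v)[p]`**: at a finite `v ∤ p` where `E(K_v^nr)[p^∞]`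
is killed by `p` (`hI`), any nonzero `T ∈ E(K_v)` with `p • T = 0` yields
`∃ u ∈ H¹_ur(K_v, E[p]), u ∉ 𝓚_v`. At an additive Tamagawa place (`p` odd, `p ∣ c_v`) both inputs
hold. [cite: GreenbergLNM1716, §2, p. 74] [cite: MilneADT2006, Ch. I, Lemma 2.9 and §3 Prop. 3.8] -/
theorem exists_mem_unramifiedSubgroup_not_mem_kummerLocalConditionAt_of_inertia_torsion_of_point
    (hpv : ((p : ℕ) : 𝓞 K) ∉ v.asIdeal)
    (hI : ∀ Q : W.geomPrimaryTorsion p,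
      (∀ τ ∈ absInertia (v.adicCompletion K),
        GaloisRep.restrictField (v.adicCompletion K) (LocBridge.primaryGaloisModule W p) τ Q = Q) →
      p • Q = 0)
    {T : (W.baseChange (v.adicCompletion K)).toAffine.Point} (hT : T ≠ 0) (hpT : (p : ℤ) • T = 0) :
    ∃ u ∈ DiscreteGaloisModule.unramifiedSubgroup
        (GaloisRep.restrictField (v.adicCompletion K) (W.torsionGaloisModule (p : ℤ))) 1,
      u ∉ W.kummerLocalConditionAt (p : ℤ) (v.adicCompletion K) := by
  obtain ⟨P, hP, hPfix⟩ := exists_geomTorsion_ne_zero_fixed_of_point W p (v.adicCompletion K) hT hpT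
  exact exists_mem_unramifiedSubgroup_not_mem_kummerLocalConditionAt_of_inertia_torsion W p v hpv
    hI hP hPfix

/-- **Index form: `[H¹_ur ⊔ 𝓚_v : 𝓚_v] = #E(K_v)[p]`** (as `#E[p]^{Γ_{K_v}}`) at `v ∤ p` under `hI`
— the factor `[𝓖_v : 𝓚_v]` gained by relaxing the Kummer structure to "Kummer + unramified" at `v`
in the count of T-E3g-BUD0 FILE 4: `𝓚_v.relIndex (H¹_ur ⊔ 𝓚_v) = 𝓚_v.relIndex H¹_ur =
(H¹_ur ⊓ 𝓚_v).relIndex H¹_ur = #H¹_ur = #E[p]^{Γ_{K_v}}` (§2).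
[cite: MilneADT2006, Ch. I, Lemma 2.9 and §3 Prop. 3.8] -/
theorem relIndex_kummerLocalConditionAt_sup_unramifiedSubgroup_of_inertia_torsion
    (hpv : ((p : ℕ) : 𝓞 K) ∉ v.asIdeal)
    (hI : ∀ Q : W.geomPrimaryTorsion p,
      (∀ τ ∈ absInertia (v.adicCompletion K),
        GaloisRep.restrictField (v.adicCompletion K) (LocBridge.primaryGaloisModule W p) τ Q = Q) →
      p • Q = 0) :
    (W.kummerLocalConditionAt (p : ℤ) (v.adicCompletion K)).relIndex
        (DiscreteGaloisModule.unramifiedSubgroup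
            (GaloisRep.restrictField (v.adicCompletion K) (W.torsionGaloisModule (p : ℤ))) 1 ⊔
          W.kummerLocalConditionAt (p : ℤ) (v.adicCompletion K)) =
      Nat.card (GaloisRep.restrictField (v.adicCompletion K)
        (W.torsionGaloisModule (p : ℤ))).toTopRep.ρ.invariants := by
  haveI : NeZero p := ⟨hp.out.ne_zero⟩
  haveI : Finite (W.geomTorsion (p : ℤ)) := finite_geomTorsion_of_neZero W p
  rw [AddSubgroup.relIndex_sup_right, ← AddSubgroup.inf_relIndex_left,
    unramifiedSubgroup_inf_kummerLocalConditionAt_eq_bot_of_inertia_torsion W p v hpv hI,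
    AddSubgroup.relIndex_bot_left,
    natCard_unramifiedSubgroup_eq_natCard_invariants_general]

end Curve

end Summit.BirchSwinnertonDyer.Rank1Residual.Additive

end
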